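import Summits.BirchSwinnertonDyer.BirchSwinnertonDyer.Theorems.AlignedTransportAtTwoOffStratumPartitionTwistFamilyZhaiTransportSeeds
import Summits.BirchSwinnertonDyer.BirchSwinnertonDyer.Theorems.TwoAdicConverseFrobeniusParityTwoDivisionRoot
import HarnessLib

/-!
# Route `AlignedTransportAtTwo`, crux C2 `MainConjectureOfRankZeroBSDAtTwo` (stmt-22298), line `birth` — THE `a_q`-ODD TWIST CLASS OF `2071a1`:
# MEMBERSHIP BY ONE `decide`, and twelve explicit prime-star members `2071a1^{(q*)}` up to conductor `2071·83² = 14 267 119`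

HONEST FRAMING (cell `bsd-f1-sign2`, WIDTH-5 attach seat `bsd-line-att-p4` g25; `--supports stmt-BirchSwinnertonDyer-22298 --as helper`).
THEOREMS ONLY (no `def`, no named fact, no `sorry`). BSD is NOT proved; nothing is asserted — every row is CONDITIONAL on the displayed PRINT
named facts and the two displayed data of `2071a1` (`Dt` optimality datum, `hL : ord₂ L(2071a1,1)/Ω = 0`). The `2071a1` twin of att-p4 g24's
`…TwistFamilyZhaiTransportMembers` (`1727a1`, p752995) — g24's successor item (d); the print-transport row `bsdp_two_twist_oddTrace_2071a1` is g24's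
(`…ZhaiTransportSeeds`, p751625).

WHY. Membership in the `a_q`-odd class `T_Z(2071a1)` needs `Odd (a_q(2071a1))` for the primes `q ∣ d`; the tree's parity dictionary
`TwoAdicTwistConverse.odd_frobeniusTrace_iff_forall_ne_zero` (`a_q` odd ⟺ the `2`-division cubic `4x³ + b₂x² + 2b₄x + b₆ = 4x³ − 3x² + 76x − 128` of
Cremona's model `[1, −1, 0, 19, −32]` has NO root mod `q`) makes it ONE `decide` over `ZMod q`:
* §1 `integralModelInt_b_2071a1` (`b₂, b₄, b₆ = −3, 38, −128`), **`odd_frobeniusTrace_2071a1_of_forall_ne_zero`** (`q` odd, `q ∤ 2071`, no root mod `q` ⟹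
  `a_q` odd); the no-root certificates `forall_ne_zero_2071a1_q` for `q ∈ {5, 7, 13, 37, 41, 43, 53, 59, 61, 67, 79, 83}` (`decide +kernel`; the odd-`a_q`
  primes `q ∤ 2071` below `90`; `107`, `127` are the next ones).
* §2 **`bsdp_two_twist_2071a1_primeStar_of_forall_ne_zero`** — for an odd prime `q ∤ 2071` with no root mod `q` and `d ∈ {q, −q}`, `d ≡ 1 (mod 4)`: every
  globally minimal model `W` of `2071a1^{(d)}` has `r_an(W) = 0 ∧ rank 0 ∧ Ш(W)[2^∞] = 0 ∧ c(W)` odd `∧ BSD(W, 2)`, modulo PRINT⁷ {Zhai 1.1′/1.2′, Mazur–Rubin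
  L. 2.10, modularity, Abbes–Ullmo, Creutz–Miller, GZK} + displayed {`Dt`, `hL`} (`Δ(2071a1) = −19³·109 < 0`: either sign of `d`).
* §3 MEMBERS by `decide`: `d = 5, −7, 13, 37, 41, −43, 53, −59, 61, −67, −79, −83` — conductors `2071·d²` from `51 775` to `14 267 119`, `BSD(W, 2)` by
  print-transport with NO certificate.

PARTITION CURRENCY (D-0171): unchanged (members of the (T) twist-family row of the rank-zero leaf, settled as PRINT-TRANSPORT by p750624/p751625); the
membership TEST of `T_Z(2071a1)` is now a kernel `decide`, as for `1727a1`. Beyond-print theorem: no. BSD is NOT proved.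

References: [Zhai2016] Thm. 1.1; [MazurRubin2010] Lemma 2.10; [AbbesUllmo1996] Thm. A; [CreutzMiller2012] Thm. 1.1; [Miller2011LMS] Def. 1.1;
[CremonaAlgorithms1997] Table 1 (`2071a1`); [SilvermanAEC2009] III.2.3, V.2.
-/

set_option autoImplicit false
set_option linter.dupNamespace false

noncomputable section

open scoped Classical

open WeierstrassCurve NumberField
open Literature.NumberTheory.EllipticCurves Literature.NumberTheory.EllipticCurves.ModularForms
open Literature.NumberTheory.EllipticCurves.Rank1Residual Literature.NumberTheory.EllipticCurves.Rank1Residual.Typed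
open Literature.NumberTheory.EllipticCurves.CoatesLiTianZhai2015 Literature.NumberTheory.EllipticCurves.Zhai2016
open Summit.BirchSwinnertonDyer.Rank1Residual Summit.BirchSwinnertonDyer.Rank1Residual.X5
open Summit.BirchSwinnertonDyer.Uniform
open Summit.BirchSwinnertonDyer.BirchSwinnertonDyer.Theorems.TowerClass
open Summit.BirchSwinnertonDyer.BirchSwinnertonDyer.Theorems.AlignedTransportAtTwoTwistFamilySmallSeeds
open Summit.BirchSwinnertonDyer.BirchSwinnertonDyer.Theorems.AlignedTransportAtTwoTwistFamilyZhaiTransport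
open Summit.BirchSwinnertonDyer.BirchSwinnertonDyer.Theorems.AlignedTransportAtTwoTwistFamilyZhaiTransportSeeds
open Summit.BirchSwinnertonDyer.BirchSwinnertonDyer.Theorems

namespace Summit.BirchSwinnertonDyer.BirchSwinnertonDyer.Theorems.AlignedTransportAtTwoTwistFamilyZhaiTransportMembers2071a1

/-! ## §1 `a_q(2071a1)` odd from «no root of `4x³ − 3x² + 76x − 128` mod `q`» -/

/-- The `b`-invariants of the integral model of `2071a1`: `b₂ = −3`, `b₄ = 38`, `b₆ = −128`. [cite: CremonaAlgorithms1997, Table 1] -/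
theorem integralModelInt_b_2071a1 : (integralModelInt c2071a1).b₂ = -3 ∧ (integralModelInt c2071a1).b₄ = 38 ∧
    (integralModelInt c2071a1).b₆ = -128 := by
  have h : integralModelInt c2071a1 = M2071a1 := Instances.integralModelInt_baseChange_int M2071a1
  rw [h]
  exact ⟨by decide, by decide, by decide⟩

/-- **`a_q(2071a1)` odd from one `decide`**: for an odd prime `q ∤ 2071`, if `4x³ − 3x² + 76x − 128` has no root in `ℤ/q` then `a_q(2071a1)` is odd
(tree dictionary `TwoAdicTwistConverse.odd_frobeniusTrace_iff_forall_ne_zero`; good reduction at `q ∤ N = 2071`). [cite: SilvermanAEC2009, III.2.3 and V.2] -/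
theorem odd_frobeniusTrace_2071a1_of_forall_ne_zero {q : ℕ} [Fact q.Prime] (hq2 : q ≠ 2) (hqN : ¬ q ∣ 2071)
    (hno : ∀ x : ZMod q, 4 * x ^ 3 - 3 * x ^ 2 + 76 * x - 128 ≠ 0) : Odd (c2071a1.frobeniusTrace q) := by
  have hgood : c2071a1.HasGoodReductionAtPrime q := by
    by_contra h
    exact hqN (by rw [← conductorNorm_2071a1]; exact (c2071a1.dvd_conductorNorm_iff_not_hasGoodReductionAtPrime q).mpr h)
  rw [TwoAdicTwistConverse.odd_frobeniusTrace_iff_forall_ne_zero c2071a1 q hq2 hgood, integralModelInt_b_2071a1.1,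
    integralModelInt_b_2071a1.2.1, integralModelInt_b_2071a1.2.2]
  intro x
  have h := hno x
  push_cast
  intro h'
  apply h
  linear_combination h'

/-- No root of `4x³ − 3x² + 76x − 128` mod `5` (so `a_{5}(2071a1)` is odd). [cite: CremonaAlgorithms1997, Table 1] -/
theorem forall_ne_zero_2071a1_5 : ∀ x : ZMod 5, 4 * x ^ 3 - 3 * x ^ 2 + 76 * x - 128 ≠ 0 := by decide +kernel

/-- No root of `4x³ − 3x² + 76x − 128` mod `7` (so `a_{7}(2071a1)` is odd). [cite: CremonaAlgorithms1997, Table 1] -/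
theorem forall_ne_zero_2071a1_7 : ∀ x : ZMod 7, 4 * x ^ 3 - 3 * x ^ 2 + 76 * x - 128 ≠ 0 := by decide +kernel

/-- No root of `4x³ − 3x² + 76x − 128` mod `13` (so `a_{13}(2071a1)` is odd). [cite: CremonaAlgorithms1997, Table 1] -/
theorem forall_ne_zero_2071a1_13 : ∀ x : ZMod 13, 4 * x ^ 3 - 3 * x ^ 2 + 76 * x - 128 ≠ 0 := by decide +kernel

/-- No root of `4x³ − 3x² + 76x − 128` mod `37` (so `a_{37}(2071a1)` is odd). [cite: CremonaAlgorithms1997, Table 1] -/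
theorem forall_ne_zero_2071a1_37 : ∀ x : ZMod 37, 4 * x ^ 3 - 3 * x ^ 2 + 76 * x - 128 ≠ 0 := by decide +kernel

/-- No root of `4x³ − 3x² + 76x − 128` mod `41` (so `a_{41}(2071a1)` is odd). [cite: CremonaAlgorithms1997, Table 1] -/
theorem forall_ne_zero_2071a1_41 : ∀ x : ZMod 41, 4 * x ^ 3 - 3 * x ^ 2 + 76 * x - 128 ≠ 0 := by decide +kernel

/-- No root of `4x³ − 3x² + 76x − 128` mod `43` (so `a_{43}(2071a1)` is odd). [cite: CremonaAlgorithms1997, Table 1] -/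
theorem forall_ne_zero_2071a1_43 : ∀ x : ZMod 43, 4 * x ^ 3 - 3 * x ^ 2 + 76 * x - 128 ≠ 0 := by decide +kernel

/-- No root of `4x³ − 3x² + 76x − 128` mod `53` (so `a_{53}(2071a1)` is odd). [cite: CremonaAlgorithms1997, Table 1] -/
theorem forall_ne_zero_2071a1_53 : ∀ x : ZMod 53, 4 * x ^ 3 - 3 * x ^ 2 + 76 * x - 128 ≠ 0 := by decide +kernel

/-- No root of `4x³ − 3x² + 76x − 128` mod `59` (so `a_{59}(2071a1)` is odd). [cite: CremonaAlgorithms1997, Table 1] -/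
theorem forall_ne_zero_2071a1_59 : ∀ x : ZMod 59, 4 * x ^ 3 - 3 * x ^ 2 + 76 * x - 128 ≠ 0 := by decide +kernel

/-- No root of `4x³ − 3x² + 76x − 128` mod `61` (so `a_{61}(2071a1)` is odd). [cite: CremonaAlgorithms1997, Table 1] -/
theorem forall_ne_zero_2071a1_61 : ∀ x : ZMod 61, 4 * x ^ 3 - 3 * x ^ 2 + 76 * x - 128 ≠ 0 := by decide +kernel

/-- No root of `4x³ − 3x² + 76x − 128` mod `67` (so `a_{67}(2071a1)` is odd). [cite: CremonaAlgorithms1997, Table 1] -/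
theorem forall_ne_zero_2071a1_67 : ∀ x : ZMod 67, 4 * x ^ 3 - 3 * x ^ 2 + 76 * x - 128 ≠ 0 := by decide +kernel

/-- No root of `4x³ − 3x² + 76x − 128` mod `79` (so `a_{79}(2071a1)` is odd). [cite: CremonaAlgorithms1997, Table 1] -/
theorem forall_ne_zero_2071a1_79 : ∀ x : ZMod 79, 4 * x ^ 3 - 3 * x ^ 2 + 76 * x - 128 ≠ 0 := by decide +kernel

/-- No root of `4x³ − 3x² + 76x − 128` mod `83` (so `a_{83}(2071a1)` is odd). [cite: CremonaAlgorithms1997, Table 1] -/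
theorem forall_ne_zero_2071a1_83 : ∀ x : ZMod 83, 4 * x ^ 3 - 3 * x ^ 2 + 76 * x - 128 ≠ 0 := by decide +kernel

/-! ## §2 Prime-star members of the `a_q`-odd class -/

section Members

variable (W : WeierstrassCurve ℚ) [W.IsElliptic] [W.IsGloballyMinimal]
  (h11 : thm11_ordTwo_LAlg_twist_eq_zero') (h12 : thm12_ordTwo_LAlg_twist_eq_one')
  (hMR' : MazurRubin2010.d2_eq_of_lemma210_rat) (hmod : exists_isNewformOf)
  (hAU : abbesUllmo_not_dvd_maninConstant_of_not_dvd_level)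
  (hCM : bsdTriple_of_rank_le_one_of_conductor_lt) (hGZK : rank_eq_analyticRank_of_analyticRank_le_one)

include h11 h12 hMR' hmod hAU hCM hGZK in
/-- **`BSD(W, 2)` by PRINT-TRANSPORT for every globally minimal model `W` of `2071a1^{(d)}`, `d = ±q` a prime-star** (`q` an odd prime, `q ∤ 2071`,
`d ∈ {q, −q}` with `d ≡ 1 (mod 4)`, and `4x³ − 3x² + 76x − 128` without root mod `q` — i.e. `a_q(2071a1)` odd, one `decide`): `r_an(W) = 0 ∧ rank 0 ∧
Ш(W)[2^∞] = 0 ∧ c(W)` odd `∧ BSD(W, 2)`, modulo PRINT⁷ {Zhai 1.1′/1.2′, Mazur–Rubin L. 2.10, modularity, Abbes–Ullmo, Creutz–Miller, GZK} +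
displayed {`Dt`, `hL`} of `2071a1`. No Kato, no certificate. CONDITIONAL; BSD is NOT proved. [cite: Zhai2016, Thm. 1.1]
[cite: MazurRubin2010, Lemma 2.10] [cite: CreutzMiller2012, Thm. 1.1] [cite: AbbesUllmo1996, Thm. A] [cite: Miller2011LMS, Def. 1.1] -/
theorem bsdp_two_twist_2071a1_primeStar_of_forall_ne_zero [NeZero (c2071a1.conductorNorm ℤ)]
    (Dt : ModularParametrizationData c2071a1 (c2071a1.conductorNorm ℤ)) (hopt : Zhai2021.IsOptimalDatum c2071a1 Dt)
    (hL : ∃ x : ℚ, IsLAlg c2071a1 x ∧ x ≠ 0 ∧ padicValRat 2 x = 0)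
    {q : ℕ} [Fact q.Prime] (hq2 : q ≠ 2) (hqN : ¬ q ∣ 2071) (hno : ∀ x : ZMod q, 4 * x ^ 3 - 3 * x ^ 2 + 76 * x - 128 ≠ 0)
    {d : ℤ} (hd : d = q ∨ d = -q) (hd4 : d % 4 = 1)
    {c : VariableChange ℚ} (hc : c • c2071a1.quadraticTwist (d : ℚ) = W) :
    W.analyticRank = 0 ∧ W.mordellWeilRank = 0 ∧ AddCommGroup.primaryComponent W.sha 2 = ⊥ ∧ Odd W.tamagawaProduct ∧ BSDp W 2 := by
  have hq : q.Prime := Fact.out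
  have hdabs : d.natAbs = q := by rcases hd with rfl | rfl <;> simp
  have hsqf : Squarefree d := by
    rw [← Int.squarefree_natAbs, hdabs]; exact hq.squarefree
  have hd1 : d ≠ 1 := by
    rintro rfl
    rw [Int.natAbs_one] at hdabs
    exact hq.one_lt.ne hdabs
  have hgcd : Int.gcd d 2071 = 1 := by
    rw [Int.gcd_eq_natAbs, hdabs]
    exact (Nat.Prime.coprime_iff_not_dvd hq).mpr hqN
  refine bsdp_two_twist_oddTrace_2071a1 W h11 h12 hMR' hmod hAU hCM hGZK Dt hopt hL hsqf hd1 hd4 hgcd (fun p hp hpd ↦ ?_) hc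
  have hpq : p = q := by
    have h1 : p ∣ d.natAbs := Int.natCast_dvd.mp hpd
    rw [hdabs] at h1
    exact (Nat.prime_dvd_prime_iff_eq hp hq).mp h1
  subst hpq
  exact odd_frobeniusTrace_2071a1_of_forall_ne_zero hq2 hqN hno

/-! ## §3 Members by `decide` -/

include h11 h12 hMR' hmod hAU hCM hGZK in
/-- **`BSD(W, 2)` by print-transport for every globally minimal model of `2071a1^{(5)}`** (`N = 51 775`; no root mod `5`, `decide`). CONDITIONAL;
BSD is NOT proved. [cite: Zhai2016, Thm. 1.1] [cite: MazurRubin2010, Lemma 2.10] [cite: CreutzMiller2012, Thm. 1.1] [cite: Miller2011LMS, Def. 1.1] -/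
theorem bsdp_two_twist_2071a1_5 [NeZero (c2071a1.conductorNorm ℤ)]
    (Dt : ModularParametrizationData c2071a1 (c2071a1.conductorNorm ℤ)) (hopt : Zhai2021.IsOptimalDatum c2071a1 Dt)
    (hL : ∃ x : ℚ, IsLAlg c2071a1 x ∧ x ≠ 0 ∧ padicValRat 2 x = 0)
    {c : VariableChange ℚ} (hc : c • c2071a1.quadraticTwist ((5 : ℤ) : ℚ) = W) : BSDp W 2 :=
  haveI : Fact (Nat.Prime 5) := ⟨by norm_num⟩
  (bsdp_two_twist_2071a1_primeStar_of_forall_ne_zero W h11 h12 hMR' hmod hAU hCM hGZK Dt hopt hL (q := 5) (by norm_num) (by norm_num)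
    forall_ne_zero_2071a1_5 (Or.inl (by norm_num)) (by decide) hc).2.2.2.2

include h11 h12 hMR' hmod hAU hCM hGZK in
/-- **`BSD(W, 2)` by print-transport for every globally minimal model of `2071a1^{(-7)}`** (`N = 101 479`; no root mod `7`, `decide`). CONDITIONAL;
BSD is NOT proved. [cite: Zhai2016, Thm. 1.1] [cite: MazurRubin2010, Lemma 2.10] [cite: CreutzMiller2012, Thm. 1.1] [cite: Miller2011LMS, Def. 1.1] -/
theorem bsdp_two_twist_2071a1_neg7 [NeZero (c2071a1.conductorNorm ℤ)]
    (Dt : ModularParametrizationData c2071a1 (c2071a1.conductorNorm ℤ)) (hopt : Zhai2021.IsOptimalDatum c2071a1 Dt)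
    (hL : ∃ x : ℚ, IsLAlg c2071a1 x ∧ x ≠ 0 ∧ padicValRat 2 x = 0)
    {c : VariableChange ℚ} (hc : c • c2071a1.quadraticTwist ((-7 : ℤ) : ℚ) = W) : BSDp W 2 :=
  haveI : Fact (Nat.Prime 7) := ⟨by norm_num⟩
  (bsdp_two_twist_2071a1_primeStar_of_forall_ne_zero W h11 h12 hMR' hmod hAU hCM hGZK Dt hopt hL (q := 7) (by norm_num) (by norm_num)
    forall_ne_zero_2071a1_7 (Or.inr (by norm_num)) (by decide) hc).2.2.2.2

include h11 h12 hMR' hmod hAU hCM hGZK in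
/-- **`BSD(W, 2)` by print-transport for every globally minimal model of `2071a1^{(13)}`** (`N = 349 999`; no root mod `13`, `decide`). CONDITIONAL;
BSD is NOT proved. [cite: Zhai2016, Thm. 1.1] [cite: MazurRubin2010, Lemma 2.10] [cite: CreutzMiller2012, Thm. 1.1] [cite: Miller2011LMS, Def. 1.1] -/
theorem bsdp_two_twist_2071a1_13 [NeZero (c2071a1.conductorNorm ℤ)]
    (Dt : ModularParametrizationData c2071a1 (c2071a1.conductorNorm ℤ)) (hopt : Zhai2021.IsOptimalDatum c2071a1 Dt)
    (hL : ∃ x : ℚ, IsLAlg c2071a1 x ∧ x ≠ 0 ∧ padicValRat 2 x = 0)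
    {c : VariableChange ℚ} (hc : c • c2071a1.quadraticTwist ((13 : ℤ) : ℚ) = W) : BSDp W 2 :=
  haveI : Fact (Nat.Prime 13) := ⟨by norm_num⟩
  (bsdp_two_twist_2071a1_primeStar_of_forall_ne_zero W h11 h12 hMR' hmod hAU hCM hGZK Dt hopt hL (q := 13) (by norm_num) (by norm_num)
    forall_ne_zero_2071a1_13 (Or.inl (by norm_num)) (by decide) hc).2.2.2.2

include h11 h12 hMR' hmod hAU hCM hGZK in
/-- **`BSD(W, 2)` by print-transport for every globally minimal model of `2071a1^{(37)}`** (`N = 2 835 199`; no root mod `37`, `decide`). CONDITIONAL;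
BSD is NOT proved. [cite: Zhai2016, Thm. 1.1] [cite: MazurRubin2010, Lemma 2.10] [cite: CreutzMiller2012, Thm. 1.1] [cite: Miller2011LMS, Def. 1.1] -/
theorem bsdp_two_twist_2071a1_37 [NeZero (c2071a1.conductorNorm ℤ)]
    (Dt : ModularParametrizationData c2071a1 (c2071a1.conductorNorm ℤ)) (hopt : Zhai2021.IsOptimalDatum c2071a1 Dt)
    (hL : ∃ x : ℚ, IsLAlg c2071a1 x ∧ x ≠ 0 ∧ padicValRat 2 x = 0)
    {c : VariableChange ℚ} (hc : c • c2071a1.quadraticTwist ((37 : ℤ) : ℚ) = W) : BSDp W 2 :=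
  haveI : Fact (Nat.Prime 37) := ⟨by norm_num⟩
  (bsdp_two_twist_2071a1_primeStar_of_forall_ne_zero W h11 h12 hMR' hmod hAU hCM hGZK Dt hopt hL (q := 37) (by norm_num) (by norm_num)
    forall_ne_zero_2071a1_37 (Or.inl (by norm_num)) (by decide) hc).2.2.2.2

include h11 h12 hMR' hmod hAU hCM hGZK in
/-- **`BSD(W, 2)` by print-transport for every globally minimal model of `2071a1^{(41)}`** (`N = 3 481 351`; no root mod `41`, `decide`). CONDITIONAL;
BSD is NOT proved. [cite: Zhai2016, Thm. 1.1] [cite: MazurRubin2010, Lemma 2.10] [cite: CreutzMiller2012, Thm. 1.1] [cite: Miller2011LMS, Def. 1.1] -/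
theorem bsdp_two_twist_2071a1_41 [NeZero (c2071a1.conductorNorm ℤ)]
    (Dt : ModularParametrizationData c2071a1 (c2071a1.conductorNorm ℤ)) (hopt : Zhai2021.IsOptimalDatum c2071a1 Dt)
    (hL : ∃ x : ℚ, IsLAlg c2071a1 x ∧ x ≠ 0 ∧ padicValRat 2 x = 0)
    {c : VariableChange ℚ} (hc : c • c2071a1.quadraticTwist ((41 : ℤ) : ℚ) = W) : BSDp W 2 :=
  haveI : Fact (Nat.Prime 41) := ⟨by norm_num⟩
  (bsdp_two_twist_2071a1_primeStar_of_forall_ne_zero W h11 h12 hMR' hmod hAU hCM hGZK Dt hopt hL (q := 41) (by norm_num) (by norm_num)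
    forall_ne_zero_2071a1_41 (Or.inl (by norm_num)) (by decide) hc).2.2.2.2

include h11 h12 hMR' hmod hAU hCM hGZK in
/-- **`BSD(W, 2)` by print-transport for every globally minimal model of `2071a1^{(-43)}`** (`N = 3 829 279`; no root mod `43`, `decide`). CONDITIONAL;
BSD is NOT proved. [cite: Zhai2016, Thm. 1.1] [cite: MazurRubin2010, Lemma 2.10] [cite: CreutzMiller2012, Thm. 1.1] [cite: Miller2011LMS, Def. 1.1] -/
theorem bsdp_two_twist_2071a1_neg43 [NeZero (c2071a1.conductorNorm ℤ)]
    (Dt : ModularParametrizationData c2071a1 (c2071a1.conductorNorm ℤ)) (hopt : Zhai2021.IsOptimalDatum c2071a1 Dt)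
    (hL : ∃ x : ℚ, IsLAlg c2071a1 x ∧ x ≠ 0 ∧ padicValRat 2 x = 0)
    {c : VariableChange ℚ} (hc : c • c2071a1.quadraticTwist ((-43 : ℤ) : ℚ) = W) : BSDp W 2 :=
  haveI : Fact (Nat.Prime 43) := ⟨by norm_num⟩
  (bsdp_two_twist_2071a1_primeStar_of_forall_ne_zero W h11 h12 hMR' hmod hAU hCM hGZK Dt hopt hL (q := 43) (by norm_num) (by norm_num)
    forall_ne_zero_2071a1_43 (Or.inr (by norm_num)) (by decide) hc).2.2.2.2

include h11 h12 hMR' hmod hAU hCM hGZK in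
/-- **`BSD(W, 2)` by print-transport for every globally minimal model of `2071a1^{(53)}`** (`N = 5 817 439`; no root mod `53`, `decide`). CONDITIONAL;
BSD is NOT proved. [cite: Zhai2016, Thm. 1.1] [cite: MazurRubin2010, Lemma 2.10] [cite: CreutzMiller2012, Thm. 1.1] [cite: Miller2011LMS, Def. 1.1] -/
theorem bsdp_two_twist_2071a1_53 [NeZero (c2071a1.conductorNorm ℤ)]
    (Dt : ModularParametrizationData c2071a1 (c2071a1.conductorNorm ℤ)) (hopt : Zhai2021.IsOptimalDatum c2071a1 Dt)
    (hL : ∃ x : ℚ, IsLAlg c2071a1 x ∧ x ≠ 0 ∧ padicValRat 2 x = 0)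
    {c : VariableChange ℚ} (hc : c • c2071a1.quadraticTwist ((53 : ℤ) : ℚ) = W) : BSDp W 2 :=
  haveI : Fact (Nat.Prime 53) := ⟨by norm_num⟩
  (bsdp_two_twist_2071a1_primeStar_of_forall_ne_zero W h11 h12 hMR' hmod hAU hCM hGZK Dt hopt hL (q := 53) (by norm_num) (by norm_num)
    forall_ne_zero_2071a1_53 (Or.inl (by norm_num)) (by decide) hc).2.2.2.2

include h11 h12 hMR' hmod hAU hCM hGZK in
/-- **`BSD(W, 2)` by print-transport for every globally minimal model of `2071a1^{(-59)}`** (`N = 7 209 151`; no root mod `59`, `decide`). CONDITIONAL;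
BSD is NOT proved. [cite: Zhai2016, Thm. 1.1] [cite: MazurRubin2010, Lemma 2.10] [cite: CreutzMiller2012, Thm. 1.1] [cite: Miller2011LMS, Def. 1.1] -/
theorem bsdp_two_twist_2071a1_neg59 [NeZero (c2071a1.conductorNorm ℤ)]
    (Dt : ModularParametrizationData c2071a1 (c2071a1.conductorNorm ℤ)) (hopt : Zhai2021.IsOptimalDatum c2071a1 Dt)
    (hL : ∃ x : ℚ, IsLAlg c2071a1 x ∧ x ≠ 0 ∧ padicValRat 2 x = 0)
    {c : VariableChange ℚ} (hc : c • c2071a1.quadraticTwist ((-59 : ℤ) : ℚ) = W) : BSDp W 2 :=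
  haveI : Fact (Nat.Prime 59) := ⟨by norm_num⟩
  (bsdp_two_twist_2071a1_primeStar_of_forall_ne_zero W h11 h12 hMR' hmod hAU hCM hGZK Dt hopt hL (q := 59) (by norm_num) (by norm_num)
    forall_ne_zero_2071a1_59 (Or.inr (by norm_num)) (by decide) hc).2.2.2.2

include h11 h12 hMR' hmod hAU hCM hGZK in
/-- **`BSD(W, 2)` by print-transport for every globally minimal model of `2071a1^{(61)}`** (`N = 7 706 191`; no root mod `61`, `decide`). CONDITIONAL;
BSD is NOT proved. [cite: Zhai2016, Thm. 1.1] [cite: MazurRubin2010, Lemma 2.10] [cite: CreutzMiller2012, Thm. 1.1] [cite: Miller2011LMS, Def. 1.1] -/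
theorem bsdp_two_twist_2071a1_61 [NeZero (c2071a1.conductorNorm ℤ)]
    (Dt : ModularParametrizationData c2071a1 (c2071a1.conductorNorm ℤ)) (hopt : Zhai2021.IsOptimalDatum c2071a1 Dt)
    (hL : ∃ x : ℚ, IsLAlg c2071a1 x ∧ x ≠ 0 ∧ padicValRat 2 x = 0)
    {c : VariableChange ℚ} (hc : c • c2071a1.quadraticTwist ((61 : ℤ) : ℚ) = W) : BSDp W 2 :=
  haveI : Fact (Nat.Prime 61) := ⟨by norm_num⟩
  (bsdp_two_twist_2071a1_primeStar_of_forall_ne_zero W h11 h12 hMR' hmod hAU hCM hGZK Dt hopt hL (q := 61) (by norm_num) (by norm_num)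
    forall_ne_zero_2071a1_61 (Or.inl (by norm_num)) (by decide) hc).2.2.2.2

include h11 h12 hMR' hmod hAU hCM hGZK in
/-- **`BSD(W, 2)` by print-transport for every globally minimal model of `2071a1^{(-67)}`** (`N = 9 296 719`; no root mod `67`, `decide`). CONDITIONAL;
BSD is NOT proved. [cite: Zhai2016, Thm. 1.1] [cite: MazurRubin2010, Lemma 2.10] [cite: CreutzMiller2012, Thm. 1.1] [cite: Miller2011LMS, Def. 1.1] -/
theorem bsdp_two_twist_2071a1_neg67 [NeZero (c2071a1.conductorNorm ℤ)]
    (Dt : ModularParametrizationData c2071a1 (c2071a1.conductorNorm ℤ)) (hopt : Zhai2021.IsOptimalDatum c2071a1 Dt)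
    (hL : ∃ x : ℚ, IsLAlg c2071a1 x ∧ x ≠ 0 ∧ padicValRat 2 x = 0)
    {c : VariableChange ℚ} (hc : c • c2071a1.quadraticTwist ((-67 : ℤ) : ℚ) = W) : BSDp W 2 :=
  haveI : Fact (Nat.Prime 67) := ⟨by norm_num⟩
  (bsdp_two_twist_2071a1_primeStar_of_forall_ne_zero W h11 h12 hMR' hmod hAU hCM hGZK Dt hopt hL (q := 67) (by norm_num) (by norm_num)
    forall_ne_zero_2071a1_67 (Or.inr (by norm_num)) (by decide) hc).2.2.2.2

include h11 h12 hMR' hmod hAU hCM hGZK in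
/-- **`BSD(W, 2)` by print-transport for every globally minimal model of `2071a1^{(-79)}`** (`N = 12 925 111`; no root mod `79`, `decide`). CONDITIONAL;
BSD is NOT proved. [cite: Zhai2016, Thm. 1.1] [cite: MazurRubin2010, Lemma 2.10] [cite: CreutzMiller2012, Thm. 1.1] [cite: Miller2011LMS, Def. 1.1] -/
theorem bsdp_two_twist_2071a1_neg79 [NeZero (c2071a1.conductorNorm ℤ)]
    (Dt : ModularParametrizationData c2071a1 (c2071a1.conductorNorm ℤ)) (hopt : Zhai2021.IsOptimalDatum c2071a1 Dt)
    (hL : ∃ x : ℚ, IsLAlg c2071a1 x ∧ x ≠ 0 ∧ padicValRat 2 x = 0)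
    {c : VariableChange ℚ} (hc : c • c2071a1.quadraticTwist ((-79 : ℤ) : ℚ) = W) : BSDp W 2 :=
  haveI : Fact (Nat.Prime 79) := ⟨by norm_num⟩
  (bsdp_two_twist_2071a1_primeStar_of_forall_ne_zero W h11 h12 hMR' hmod hAU hCM hGZK Dt hopt hL (q := 79) (by norm_num) (by norm_num)
    forall_ne_zero_2071a1_79 (Or.inr (by norm_num)) (by decide) hc).2.2.2.2

include h11 h12 hMR' hmod hAU hCM hGZK in
/-- **`BSD(W, 2)` by print-transport for every globally minimal model of `2071a1^{(-83)}`** (`N = 14 267 119`; no root mod `83`, `decide`). CONDITIONAL;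
BSD is NOT proved. [cite: Zhai2016, Thm. 1.1] [cite: MazurRubin2010, Lemma 2.10] [cite: CreutzMiller2012, Thm. 1.1] [cite: Miller2011LMS, Def. 1.1] -/
theorem bsdp_two_twist_2071a1_neg83 [NeZero (c2071a1.conductorNorm ℤ)]
    (Dt : ModularParametrizationData c2071a1 (c2071a1.conductorNorm ℤ)) (hopt : Zhai2021.IsOptimalDatum c2071a1 Dt)
    (hL : ∃ x : ℚ, IsLAlg c2071a1 x ∧ x ≠ 0 ∧ padicValRat 2 x = 0)
    {c : VariableChange ℚ} (hc : c • c2071a1.quadraticTwist ((-83 : ℤ) : ℚ) = W) : BSDp W 2 :=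
  haveI : Fact (Nat.Prime 83) := ⟨by norm_num⟩
  (bsdp_two_twist_2071a1_primeStar_of_forall_ne_zero W h11 h12 hMR' hmod hAU hCM hGZK Dt hopt hL (q := 83) (by norm_num) (by norm_num)
    forall_ne_zero_2071a1_83 (Or.inr (by norm_num)) (by decide) hc).2.2.2.2

end Members

end Summit.BirchSwinnertonDyer.BirchSwinnertonDyer.Theorems.AlignedTransportAtTwoTwistFamilyZhaiTransportMembers2071a1

end
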